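import Summits.CriticalPhenomena.PercolationContinuityZ3.Theorems.PercNearOneGluingNoHeavyLowerTailSunflowerTwoPointCompleting
import Summits.CriticalPhenomena.PercolationContinuityZ3.Theorems.PercNearOneGluingNoHeavyLowerTailSunflowerGoodCoordinate
import HarnessLib

/-!
# `NoHeavyLowerTail` (crux stmt-CriticalPhenomena-4575), abstract sunflower cubic: the first STRUCTURED two-point certificate —
# ★-REDUCTION AT A RAINBOW TRIANGLE EDGE WITH ENDPOINTS OF DEGREE 2

Support file (seat `prim-ineq-gen-2` gen 25; `--supports stmt-CriticalPhenomena-4575`).  No `sorry`, no named facts; nothing is asserted about the crux.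
Memo: run/shared/lean/prim/prim-ineq-gen-2/TWO-POINT-GEN25.md §7–§9 (this is the `({2},{3})`-with-shared-external edge type; first brick of the blueprint §9).

SETTING.  Three points `p, q, t` and a sub-cube `2^W'` (`p, q ∉ W'`, `t ∈ W'`) on which the labels see `p` and `q` ONLY through `t` and through each
other, as in a 3-edge-coloured graph where `p q` is an edge of colour `1`, `p t` of colour `2`, `q t` of colour `3` and `p, q` have no further edges:
for every `X ⊆ W'`,
  `lab (X+p) = X ∋ t ? lab X ∨ 2 : lab X`,  `lab (X+q) = X ∋ t ? lab X ∨ 3 : lab X`,  `lab (X+p+q) = X ∋ t ? ⊤ : lab X ∨ 1`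
(`∨` = join in `M₃`, `jn`).  No graph is mentioned: these are the hypotheses `hP`, `hQ`, `hPQ` of the theorem.

THEOREM `Sunflower.two_ZP_insert_insert_ge_of_triangleEdge` (this work):
  `4·(F.con p).ZP W' ∅ ∅ ∅ + (F.con q).ZP W' ∅ ∅ ∅ + 3·F.ZP (insert q W') ∅ ∅ ∅ ≤ 2·F.ZP (insert p (insert q W')) ∅ ∅ ∅`,
i.e. `Z` of the sub-cube on `W' + p + q` dominates a positive combination of `Z` of three proper MINORS (contract `p` & delete `q`; contract `q` &
delete `p`; delete `p`).  With `0 ≤ Z` of the minors (induction inside a hereditary class) this is an inductive step for ★ that NO product-class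
two-point certificate provides (gen-23 scan: kernel/non-bottom pairs infeasible even with induction rows); it exists because the block data
`(lab X, t ∈ X)` of the three blocks of a partition of `W'` are JOINTLY constrained — exactly one block contains `t`.

PROOF.  Split the nested sum along `p` and `q` (`nested_insert_split`); per partition `(X,S,T)` of `W'` the block datum is
`((lab X, lab (X+p), lab (X+q), lab (X+p+q)), t ∈ X)`, one of 10 values (`triCode`, `exists_triCode`) with exactly one `true` bit among the three
blocks.  `2·(nine placements) − 4·conP − conQ − 3·(three placements of q)` minus two spectator-weighted antipodal-Gladkov rows (plain, weight
`triW0 ∈ {0,6}`; polarised with offsets `{p,q} ⊇ ∅`, weight `triWK ∈ {0,12}`) is the kernel `triKer`; its block-symmetrisation is `≥ 0` on every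
realisable code triple (`triKer_symm_nonneg_*`, `decide`; exact LP certificate of kit j179539 type 7, re-derived in exact arithmetic, gen25/edge_lp/).
-/

namespace Summit.CriticalPhenomena.PercolationContinuityZ3.Theorems.SunflowerPartition

open Finset

/-! ## Finite data -/

/-- Block datum of a triangle-edge window: the four section labels and the bit `t ∈ X`. [this work] -/
abbrev TriData := BlockData × Bool

/-- Join with a petal colour in `M₃` (`0 ∨ c = c`, `c ∨ c = c`, otherwise `⊤`). [this work] -/
def jn (x c : Fin 5) : Fin 5 := if x = 0 then c else if x = c then c else 4

/-- The 10 realisable block data `((x, x∨2·b, x∨3·b, b ? ⊤ : x∨1), b)`. [this work] -/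
def triCode : Fin 10 → TriData :=
  ![((0,0,0,1), false), ((1,1,1,1), false), ((2,2,2,4), false), ((3,3,3,4), false), ((4,4,4,4), false),
    ((0,2,3,4), true), ((1,4,4,4), true), ((2,2,4,4), true), ((3,4,3,4), true), ((4,4,4,4), true)]

/-- Weight (doubled certificate) of the plain antipodal-Gladkov row behind a first block with datum `a`. [this work] -/
def triW0 (a : TriData) : ℤ := if a.1.1 = 1 ∨ (a.1.1 = 0 ∧ a.2 = false) then 0 else 6

/-- Weight of the polarised row `kk (lab (S+p+q)) (lab T)` behind a first block with datum `a`. [this work] -/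
def triWK (a : TriData) : ℤ := if a.1.1 = 1 ∧ a.2 = true then 12 else 0

/-- `triW0 ≥ 0`. [this work] -/
theorem triW0_nonneg (a : TriData) : 0 ≤ triW0 a := by
  unfold triW0; split_ifs <;> norm_num

/-- `triWK ≥ 0`. [this work] -/
theorem triWK_nonneg (a : TriData) : 0 ≤ triWK a := by
  unfold triWK; split_ifs <;> norm_num

/-- The kernel: twice the nine placements of `p,q`, minus `4·`(contract `p`, delete `q`), minus (contract `q`, delete `p`), minus `3·`(the three
placements of `q` with `p` deleted), minus the two weighted rows of the first block. [this work] -/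
def triKer (a b c : TriData) : ℤ :=
  2 * nineH a.1 b.1 c.1
    - (4 * s6H a.1.2.1 b.1.2.1 c.1.2.1 + s6H a.1.2.2.1 b.1.2.2.1 c.1.2.2.1
        + 3 * (s6H a.1.2.2.1 b.1.1 c.1.1 + s6H a.1.1 b.1.2.2.1 c.1.1 + s6H a.1.1 b.1.1 c.1.2.2.1))
    - (triW0 a * kk b.1.1 c.1.1 + triWK a * kk b.1.2.2.2 c.1.1)

/-- Kernel check on realisable code triples, the `t`-block first. [this work] -/
theorem triKer_symm_nonneg_1 : ∀ i j k : Fin 10, (triCode i).2 = true → (triCode j).2 = false → (triCode k).2 = false →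
    0 ≤ symm6Of triKer (triCode i) (triCode j) (triCode k) := by
  decide

/-- Kernel check on realisable code triples, the `t`-block second. [this work] -/
theorem triKer_symm_nonneg_2 : ∀ i j k : Fin 10, (triCode i).2 = false → (triCode j).2 = true → (triCode k).2 = false →
    0 ≤ symm6Of triKer (triCode i) (triCode j) (triCode k) := by
  decide

/-- Kernel check on realisable code triples, the `t`-block third. [this work] -/
theorem triKer_symm_nonneg_3 : ∀ i j k : Fin 10, (triCode i).2 = false → (triCode j).2 = false → (triCode k).2 = true →
    0 ≤ symm6Of triKer (triCode i) (triCode j) (triCode k) := by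
  decide

/-- Kernel check on code triples without a `t`-block (the case `t ∉ W'`). [this work] -/
theorem triKer_symm_nonneg_fff : ∀ i j k : Fin 10, (triCode i).2 = false → (triCode j).2 = false → (triCode k).2 = false →
    0 ≤ symm6Of triKer (triCode i) (triCode j) (triCode k) := by
  decide

/-- The data forced by the local hypotheses are codes: bit `false`. [this work] -/
theorem exists_triCode_false : ∀ x : Fin 5, ∃ i : Fin 10, triCode i = ((x, x, x, jn x 1), false) := by
  decide

/-- The data forced by the local hypotheses are codes: bit `true`. [this work] -/
theorem exists_triCode_true : ∀ x : Fin 5, ∃ i : Fin 10, triCode i = ((x, jn x 2, jn x 3, 4), true) := by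
  decide

variable {α : Type*} [Fintype α] [DecidableEq α]

namespace Sunflower

variable (F : Sunflower α)

omit [Fintype α] in
/-- Polarised rows `kk (lab (S+p+q)) (lab T)` with a nonnegative weight of the first block are nonnegative (polarised antipodal Gladkov with
offsets `{p,q} ⊇ ∅`). [this work] -/
theorem nested_weight_mul_kk_insert_insert_left_nonneg (W : Finset α) (p q : α) (w : Finset α → ℤ) (hw : ∀ X, 0 ≤ w X) :
    0 ≤ nested W (fun X S T => w X * kk (F.lab (insert p (insert q S))) (F.lab T)) := by
  unfold nested
  refine sum_nonneg fun X _ => ?_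
  rw [← mul_sum]
  refine mul_nonneg (hw X) ?_
  have h := F.antipodal_gladkov_polarized (W \ X) {p, q} ∅ (empty_subset _)
  refine le_of_le_of_eq h (sum_congr rfl fun S _ => ?_)
  rw [insert_union, ← insert_eq, empty_union]

/-- The contraction minor as a nested sum of lifted labels. [this work] -/
theorem con_ZP_eq_nested (W : Finset α) (e : α) :
    (F.con e).ZP W ∅ ∅ ∅ = nested W (fun X S T => s6H (F.lab (insert e X)) (F.lab (insert e S)) (F.lab (insert e T))) := by
  rw [(F.con e).ZP_empty_eq_nested]
  unfold nested
  simp only [F.lab_con]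

/-- **★-reduction at a rainbow triangle edge with endpoints of degree 2** (structured two-point certificate): if on the sub-cube `2^W'`
(`p ≠ q`, `p, q ∉ W'`) the points `p, q` act only through `t` and each other — `lab (X+p) = (t ∈ X ? lab X ∨ 2 : lab X)`,
`lab (X+q) = (t ∈ X ? lab X ∨ 3 : lab X)`, `lab (X+p+q) = (t ∈ X ? ⊤ : lab X ∨ 1)` for all `X ⊆ W'` — then
`4·(F.con p).ZP W' + (F.con q).ZP W' + 3·F.ZP (W'+q) ≤ 2·F.ZP (W'+p+q)`. [this work] -/
theorem two_ZP_insert_insert_ge_of_triangleEdge (W' : Finset α) {p q t : α} (hpq : p ≠ q) (hp : p ∉ W') (hq : q ∉ W')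
    (hP : ∀ X ⊆ W', F.lab (insert p X) = if t ∈ X then jn (F.lab X) 2 else F.lab X)
    (hQ : ∀ X ⊆ W', F.lab (insert q X) = if t ∈ X then jn (F.lab X) 3 else F.lab X)
    (hPQ : ∀ X ⊆ W', F.lab (insert p (insert q X)) = if t ∈ X then 4 else jn (F.lab X) 1) :
    4 * (F.con p).ZP W' ∅ ∅ ∅ + (F.con q).ZP W' ∅ ∅ ∅ + 3 * F.ZP (insert q W') ∅ ∅ ∅
      ≤ 2 * F.ZP (insert p (insert q W')) ∅ ∅ ∅ := by
  have hpW : p ∉ insert q W' := fun hh => by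
    rcases mem_insert.1 hh with hh | hh
    · exact hpq hh
    · exact hp hh
  set G : Finset α → Finset α → Finset α → ℤ := fun X S T => s6H (F.lab X) (F.lab S) (F.lab T) with hG
  set L : Finset α → TriData := fun X => (F.blockData p q X, decide (t ∈ X)) with hL
  -- the four functionals as nested sums on `W'`
  have hZ2 : F.ZP (insert p (insert q W')) ∅ ∅ ∅ = nested (insert p (insert q W')) G := F.ZP_empty_eq_nested _
  have hZ1 : F.ZP (insert q W') ∅ ∅ ∅ = nested (insert q W') G := F.ZP_empty_eq_nested _
  have hCp := F.con_ZP_eq_nested W' p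
  have hCq := F.con_ZP_eq_nested W' q
  -- the split identity
  have hsplit : 2 * nested (insert p (insert q W')) G
      - (4 * nested W' (fun X S T => s6H (F.lab (insert p X)) (F.lab (insert p S)) (F.lab (insert p T)))
          + nested W' (fun X S T => s6H (F.lab (insert q X)) (F.lab (insert q S)) (F.lab (insert q T)))
          + 3 * nested (insert q W') G)
      = nested W' (fun X S T => triKer (L X) (L S) (L T))
        + (nested W' (fun X S T => triW0 (L X) * kk (F.lab S) (F.lab T))
          + nested W' (fun X S T => triWK (L X) * kk (F.lab (insert p (insert q S))) (F.lab T))) := by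
    rw [nested_insert_split _ p hpW, nested_insert_split _ q hq, nested_insert_split _ q hq, nested_insert_split _ q hq,
      nested_insert_split _ q hq]
    unfold nested
    simp only [hG, hL, blockData, triKer, nineH, mul_add, sum_add_distrib, sum_sub_distrib, mul_sum]
    ring
  -- kernel nonnegativity on realisable data
  have hker : 0 ≤ nested W' (fun X S T => triKer (L X) (L S) (L T)) := by
    have h6 := six_mul_nested_eq_symm6Of W' L triKer
    have hpos : 0 ≤ nested W' (fun X S T => symm6Of triKer (L X) (L S) (L T)) := by
      refine nested_nonneg_of_forall W' _ fun X hX S hS => ?_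
      have hT : (W' \ X) \ S ⊆ W' := sdiff_subset.trans sdiff_subset
      have hS' : S ⊆ W' := hS.trans sdiff_subset
      -- the code of a block `Y ⊆ W'`
      have hcode : ∀ Y ⊆ W', ∃ i : Fin 10, triCode i = L Y ∧ (triCode i).2 = decide (t ∈ Y) := by
        intro Y hY
        have e1 := hP Y hY
        have e2 := hQ Y hY
        have e3 := hPQ Y hY
        by_cases ht : t ∈ Y
        · rw [if_pos ht] at e1 e2 e3
          obtain ⟨i, hi⟩ := exists_triCode_true (F.lab Y)
          refine ⟨i, ?_, by rw [hi]; simp [ht]⟩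
          rw [hi, hL]
          simp only [blockData, e1, e2, e3, ht, decide_true]
        · rw [if_neg ht] at e1 e2 e3
          obtain ⟨i, hi⟩ := exists_triCode_false (F.lab Y)
          refine ⟨i, ?_, by rw [hi]; simp [ht]⟩
          rw [hi, hL]
          simp only [blockData, e1, e2, e3, ht, decide_false]
      obtain ⟨a, ha, ha2⟩ := hcode X hX
      obtain ⟨b, hb, hb2⟩ := hcode S hS'
      obtain ⟨c, hc, hc2⟩ := hcode ((W' \ X) \ S) hT
      rw [← ha, ← hb, ← hc]
      -- exactly one of the three disjoint blocks contains `t`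
      have hXS : Disjoint X S := disjoint_of_subset_right hS disjoint_sdiff
      by_cases htX : t ∈ X
      · have htS : t ∉ S := fun h => disjoint_left.1 hXS htX h
        have htT : t ∉ (W' \ X) \ S := fun h => (mem_sdiff.1 (mem_sdiff.1 h).1).2 htX
        exact triKer_symm_nonneg_1 a b c (by rw [ha2]; simp [htX]) (by rw [hb2]; simp [htS]) (by rw [hc2]; simp [htT])
      · by_cases htS : t ∈ S
        · have htT : t ∉ (W' \ X) \ S := fun h => (mem_sdiff.1 h).2 htS
          exact triKer_symm_nonneg_2 a b c (by rw [ha2]; simp [htX]) (by rw [hb2]; simp [htS]) (by rw [hc2]; simp [htT])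
        · by_cases htW : t ∈ W'
          · have htT : t ∈ (W' \ X) \ S := mem_sdiff.2 ⟨mem_sdiff.2 ⟨htW, htX⟩, htS⟩
            exact triKer_symm_nonneg_3 a b c (by rw [ha2]; simp [htX]) (by rw [hb2]; simp [htS]) (by rw [hc2]; simp [htT])
          · -- `t ∉ W'`: no block contains `t`
            have htT : t ∉ (W' \ X) \ S := fun h => htW ((mem_sdiff.1 (mem_sdiff.1 h).1).1)
            exact triKer_symm_nonneg_fff a b c (by rw [ha2]; simp [htX]) (by rw [hb2]; simp [htS]) (by rw [hc2]; simp [htT])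
    linarith
  have hrow0 : 0 ≤ nested W' (fun X S T => triW0 (L X) * kk (F.lab S) (F.lab T)) :=
    F.nested_weight_mul_kk_nonneg W' (fun X => triW0 (L X)) fun X => triW0_nonneg _
  have hrow1 : 0 ≤ nested W' (fun X S T => triWK (L X) * kk (F.lab (insert p (insert q S))) (F.lab T)) :=
    F.nested_weight_mul_kk_insert_insert_left_nonneg W' p q (fun X => triWK (L X)) fun X => triWK_nonneg _
  rw [hZ2, hZ1, hCp, hCq]
  linarith
end Sunflower

end Summit.CriticalPhenomena.PercolationContinuityZ3.Theorems.SunflowerPartition
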